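import Literature.Geometry.Symplectic.AxisGluingBounds
import Mathlib.Tactic.Module
import HarnessLib

/-!
# Gluing a near-symplectic form to Honda's model along an even zero circle (model level)

Topic `Geometry/Symplectic`; namespace `Literature.Geometry.Symplectic`.  Theorems only; no named
fact, no `sorry`.  The positivity estimate of Perutz 2006, proof of Lemma 3.1, for an EVEN
circle, with the Moser flow replaced by a logarithmic cut-off: let `G` be a `C^∞`, closed,
`2π`-periodic `Λ²(ℝ⁴)*`-valued map on the model tube `hondaTube r`, vanishing on the axis,
whose `1`-jet at the axis is in block form `dG_{θe₀}(W) = β(M(θ) x(W))`, `M = M⁺ ⊕ (m₃₃)`,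
`M⁺ > 0 > m₃₃` (`ZeroCircleAdaptedChart`).  Then for suitable `0 < r₀ < r₁ / 2 < r₁ < r` the form

`G' = G + d(ρ · η)`, `η = K(ω_A − G)` (`AxisGluingPrimitive`), `ρ` the logarithmic cut-off
(`TubeLogCutoff`),

is `C^∞`, closed and `2π`-periodic on the tube, equals `G` where `|x| > r₁ / 2`, equals
Honda's model `ω_A` where `|x| < r₀`, vanishes on the axis and has POSITIVE Pfaffian for
`0 < |x| ≤ r₁` — no positivity of `G` is assumed, so on the shell `r₁ / 2 < |x| ≤ r₁` this also
shows `Pf G > 0` (`exists_axisGluing`).  The estimate: on `|x| ≤ r₁`,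
`G' = β(((1−ρ)M + ρD)x) + O(|x|²) + O(η₀|x|)` with `Pf(β(Ax)) ≥ m|x|²`
(`exists_lower_bound_blockInterpolation`) and `Pf(α + β) ≥ Pf α − 6‖α‖‖β‖ − 3‖β‖²`.

## References

* T. Perutz, *Zero-sets of near-symplectic forms*, J. Symplectic Geom. 4 (2006), §3, Lemma 3.1
  and its proof. [Perutz2006]
* K. Honda, *Local properties of self-dual harmonic 2-forms on a 4-manifold*, J. reine angew.
  Math. 577 (2004), Thm. 5. [Honda2004LocalSD]
-/

noncomputable section

open scoped Manifold ContDiff Topology Real Matrix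
open Set Function Filter Metric Real Matrix Literature.Analysis.Matrix Literature.Analysis.Calculus

namespace Literature.Geometry.Symplectic

/-- The normal part of `q − q₀e₀` is that of `q`. [folklore] -/
theorem normalPart_sub_hondaAxisPoint (q : EuclideanSpace ℝ (Fin 4)) :
    normalPart (q - hondaAxisPoint (q 0)) = normalPart q := by
  funext k; simp [normalPart_apply, hondaAxisPoint_apply_succ]

/-- A point at positive distance from the axis is off the axis, and conversely. [folklore] -/
theorem norm_sub_hondaAxisPoint_pos_iff (q : EuclideanSpace ℝ (Fin 4)) :
    0 < ‖q - hondaAxisPoint (q 0)‖ ↔ q ∉ hondaAxis := by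
  rw [← not_iff_not, not_lt, not_not]
  constructor
  · intro h
    have h0 : ‖q - hondaAxisPoint (q 0)‖ = 0 := le_antisymm h (norm_nonneg _)
    rw [norm_eq_zero, sub_eq_zero] at h0
    rw [h0]; exact hondaAxisPoint_mem_hondaAxis _
  · intro h
    rw [eq_hondaAxisPoint_of_mem_hondaAxis h, hondaAxisPoint_apply_zero, sub_self, norm_zero]

set_option maxHeartbeats 1600000 in
/-- **Gluing to Honda's model along an even zero circle, model level** (Perutz 2006, proof of
Lemma 3.1; Honda 2004, Thm. 5): see the module docstring. [cite: Perutz2006, Lemma 3.1 (proof)] -/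
theorem exists_axisGluing
    {G : EuclideanSpace ℝ (Fin 4) → (EuclideanSpace ℝ (Fin 4)) [⋀^Fin 2]→L[ℝ] ℝ} {r : ℝ}
    (hr : 0 < r) (hGs : ContDiffOn ℝ ∞ G (hondaTube r))
    (hGper : ∀ q, G (q + (2 * π) • EuclideanSpace.single (0 : Fin 4) (1 : ℝ)) = G q)
    (hGcl : ∀ q ∈ hondaTube r, extDeriv G q = 0) (hG0 : ∀ θ, G (hondaAxisPoint θ) = 0)
    {M : ℝ → Matrix (Fin 3) (Fin 3) ℝ} (hMc : ∀ i j, Continuous fun θ ↦ M θ i j)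
    (hMP : ∀ θ, M (θ + 2 * π) = M θ) (hsymm : ∀ θ, (M θ).IsSymm)
    (hblock : ∀ θ (m : Fin 3), M θ m 2 = if m = 2 then M θ 2 2 else 0) (hneg : ∀ θ, M θ 2 2 < 0)
    (hpos : ∀ θ (v : Fin 3 → ℝ), v 2 = 0 → v ≠ 0 → 0 < v ⬝ᵥ M θ *ᵥ v)
    (hjet : ∀ θ W, fderiv ℝ G (hondaAxisPoint θ) W = betaForm (M θ *ᵥ normalPart W)) :
    ∃ (r₀ r₁ : ℝ) (G' : EuclideanSpace ℝ (Fin 4) → (EuclideanSpace ℝ (Fin 4)) [⋀^Fin 2]→L[ℝ] ℝ),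
      0 < r₀ ∧ r₀ < r₁ / 2 ∧ r₁ < r ∧
      ContDiffOn ℝ ∞ G' (hondaTube r) ∧ (∀ q ∈ hondaTube r, extDeriv G' q = 0) ∧
      (∀ q, G' (q + (2 * π) • EuclideanSpace.single (0 : Fin 4) (1 : ℝ)) = G' q) ∧
      (∀ q, r₁ / 2 < ‖q - hondaAxisPoint (q 0)‖ → G' q = G q) ∧
      (∀ q, ‖q - hondaAxisPoint (q 0)‖ < r₀ → G' q = hondaFormCLM q) ∧
      (∀ q, 0 < ‖q - hondaAxisPoint (q 0)‖ → ‖q - hondaAxisPoint (q 0)‖ ≤ r₁ →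
        0 < pfaffian (G' q)) ∧
      (∀ θ, G' (hondaAxisPoint θ) = 0) := by
  have hopen := isOpen_hondaTube r
  -- (0) the primitive on the half tube
  set r₂ : ℝ := r / 2 with hr₂
  have hr₂0 : 0 < r₂ := by rw [hr₂]; positivity
  have hr₂r : r₂ < r := by rw [hr₂]; linarith
  obtain ⟨η, C, C₁, hηs, hηper, hdη, hC0, hC₁0, hηb, -⟩ :=
    exists_gluingPrimitive hr₂0 hr₂r hGs hGper hGcl hG0
  -- (1) Taylor remainder of `G` on the slab `|x| ≤ r₂`
  obtain ⟨C₁G, C₂, -, hC₂0, hGb⟩ := exists_axis_taylor_bounds (hGs.of_le (by norm_cast))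
    hGper hG0 hr₂0 hr₂r
  have hrem : ∀ q, ‖q - hondaAxisPoint (q 0)‖ ≤ r₂ →
      ‖G q - betaForm (M (q 0) *ᵥ normalPart q)‖ ≤ C₂ * ‖q - hondaAxisPoint (q 0)‖ ^ 2 := by
    intro q hq
    have h := (hGb q hq).2
    rwa [hjet, normalPart_sub_hondaAxisPoint] at h
  -- (2) the constants
  obtain ⟨m, hm, hmb⟩ := exists_lower_bound_blockInterpolation hMc two_pi_pos hMP hsymm hblock
    hneg hpos
  obtain ⟨B, hB0, hB⟩ := exists_bound_periodic_matrix hMc two_pi_pos hMP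
  set Bβ : ℝ := ‖hondaBeta₁‖ + ‖hondaBeta₂‖ + ‖hondaBeta₃‖ with hBβ
  have hBβ0 : 0 ≤ Bβ := by positivity
  set CΩ : ℝ := 9 * Bβ * (B + 2) with hCΩ
  have hCΩ0 : 0 ≤ CΩ := by positivity
  -- `δ ≤ 1` with `6 CΩ δ + 3 δ² ≤ m / 2`
  set δ : ℝ := min 1 (m / (2 * (6 * CΩ + 3) + 1)) with hδ
  have hδ0 : 0 < δ := lt_min one_pos (by positivity)
  have hδ1 : δ ≤ 1 := min_le_left _ _
  have hδm : 6 * CΩ * δ + 3 * δ ^ 2 ≤ m / 2 := by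
    have h1 : 6 * CΩ * δ + 3 * δ ^ 2 ≤ (6 * CΩ + 3) * δ := by nlinarith
    have h2 : δ ≤ m / (2 * (6 * CΩ + 3) + 1) := min_le_right _ _
    have h3 : (6 * CΩ + 3) * δ ≤ (6 * CΩ + 3) * (m / (2 * (6 * CΩ + 3) + 1)) :=
      mul_le_mul_of_nonneg_left h2 (by positivity)
    have h4 : (6 * CΩ + 3) * (m / (2 * (6 * CΩ + 3) + 1)) ≤ m / 2 := by
      rw [mul_div_assoc', div_le_div_iff₀ (by positivity) (by positivity)]
      nlinarith
    linarith
  -- the gluing radius `r₁` and the cut-off parameter `η₀`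
  set r₁ : ℝ := min (r₂ / 2) (δ / (2 * (C₂ + 1))) with hr₁
  have hr₁0 : 0 < r₁ := lt_min (by positivity) (by positivity)
  have hr₁₂ : r₁ < r₂ := lt_of_le_of_lt (min_le_left _ _) (by linarith)
  have hr₁δ : C₂ * r₁ ≤ δ / 2 := by
    have h1 : r₁ ≤ δ / (2 * (C₂ + 1)) := min_le_right _ _
    have h2 : C₂ * r₁ ≤ C₂ * (δ / (2 * (C₂ + 1))) := mul_le_mul_of_nonneg_left h1 hC₂0
    have h3 : C₂ * (δ / (2 * (C₂ + 1))) ≤ δ / 2 := by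
      rw [mul_div_assoc', div_le_div_iff₀ (by positivity) (by positivity)]
      nlinarith
    linarith
  set η₀ : ℝ := δ / (8 * (C + 1)) with hη₀
  have hη₀0 : 0 < η₀ := by positivity
  have hη₀δ : 4 * η₀ * C ≤ δ / 2 := by
    rw [hη₀]
    rw [show 4 * (δ / (8 * (C + 1))) * C = (δ / 2) * (C / (C + 1)) by field_simp; ring]
    have : C / (C + 1) ≤ 1 := by rw [div_le_one (by positivity)]; linarith
    nlinarith
  -- (3) the logarithmic cut-off
  obtain ⟨r₀, hr₀0, hr₀₁, ρ, hρs, hρ1, hρ0, hρI, hρper, hρd, hρd1, -⟩ :=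
    exists_tubeLogCutoff hη₀0 (half_pos hr₁0)
  -- (4) the glued form
  set ω₁ : EuclideanSpace ℝ (Fin 4) → (EuclideanSpace ℝ (Fin 4)) [⋀^Fin 1]→L[ℝ] ℝ :=
    fun y ↦ ρ y • η y with hω₁
  have hω₁s : ContDiff ℝ ∞ ω₁ := hρs.smul hηs
  have h1 : (∞ : WithTop ℕ∞) ≠ 0 := by simp
  have hdω₁s : ContDiff ℝ ∞ (extDeriv ω₁) := by
    have heq : extDeriv ω₁ = fun x ↦ ContinuousAlternatingMap.alternatizeUncurryFinCLM ℝ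
        (EuclideanSpace ℝ (Fin 4)) ℝ (fderiv ℝ ω₁ x) := rfl
    rw [heq]
    have hf : ContDiff ℝ ∞ (fderiv ℝ ω₁) := hω₁s.fderiv_right (m := ∞) (by simp)
    exact (ContinuousAlternatingMap.alternatizeUncurryFinCLM ℝ (EuclideanSpace ℝ (Fin 4))
      ℝ).contDiff.comp hf
  set G' : EuclideanSpace ℝ (Fin 4) → (EuclideanSpace ℝ (Fin 4)) [⋀^Fin 2]→L[ℝ] ℝ :=
    fun q ↦ G q + extDeriv ω₁ q with hG'
  -- periodicity
  have hω₁per : ∀ q, ω₁ (q + (2 * π) • EuclideanSpace.single (0 : Fin 4) (1 : ℝ)) = ω₁ q :=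
    fun q ↦ by simp only [hω₁, hρper, hηper]
  have hdω₁per : ∀ q, extDeriv ω₁ (q + (2 * π) • EuclideanSpace.single (0 : Fin 4) (1 : ℝ)) =
      extDeriv ω₁ q := fun q ↦ by
    rw [extDeriv, extDeriv, fderiv_periodic hω₁per]
  -- the Leibniz formula on the half tube
  have hformula : ∀ q ∈ hondaTube r₂, extDeriv ω₁ q = ρ q • (hondaFormCLM q - G q) +
      ContinuousAlternatingMap.alternatizeUncurryFin ((fderiv ℝ ρ q).smulRight (η q)) := by
    intro q hq
    rw [hω₁, extDeriv_smul_oneForm (hρs.differentiable h1 q) (hηs.differentiable h1 q), hdη q hq]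
  -- where `ρ ≡ 0` nearby, `d ω₁ = 0`
  have hdist : Continuous fun q : EuclideanSpace ℝ (Fin 4) ↦ ‖q - hondaAxisPoint (q 0)‖ := by
    obtain ⟨L, hL⟩ := exists_normalProjCLM
    have : (fun q : EuclideanSpace ℝ (Fin 4) ↦ ‖q - hondaAxisPoint (q 0)‖) = fun q ↦ ‖L q‖ :=
      funext fun q ↦ by rw [hL]
    rw [this]; exact continuous_norm.comp L.continuous
  have hout : ∀ q, r₁ / 2 < ‖q - hondaAxisPoint (q 0)‖ → extDeriv ω₁ q = 0 := by
    intro q hq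
    have hev : ω₁ =ᶠ[𝓝 q] fun _ ↦ 0 := by
      filter_upwards [(isOpen_lt continuous_const hdist).mem_nhds hq] with q' hq'
      simp only [hω₁, hρ0 q' hq'.le, zero_smul]
    rw [hev.extDeriv_eq, extDeriv, fderiv_const_apply,
      ← ContinuousAlternatingMap.alternatizeUncurryFinCLM_apply, map_zero]
  -- membership in the half tube from the distance
  have hmem₂ : ∀ q, ‖q - hondaAxisPoint (q 0)‖ < r₂ → q ∈ hondaTube r₂ := fun q hq ↦
    (mem_hondaTube_iff_norm_lt hr₂0).2 hq
  -- near the axis `G' = ω_A`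
  have hcore : ∀ q, ‖q - hondaAxisPoint (q 0)‖ < r₀ → G' q = hondaFormCLM q := by
    intro q hq
    have hq₂ : q ∈ hondaTube r₂ := hmem₂ q (by linarith)
    simp only [hG']
    rw [hformula q hq₂, hρ1 q hq.le, one_smul, wedgeTerm_eq_zero_of_fderiv_eq_zero (hρd1 q hq)]
    abel
  have hmin : minSmoothness ℝ 2 ≤ (∞ : WithTop ℕ∞) := by
    rw [minSmoothness_of_isRCLikeNormedField]
    exact WithTop.coe_le_coe.2 le_top
  refine ⟨r₀, r₁, G', hr₀0, hr₀₁, hr₁₂.trans hr₂r, hGs.add hdω₁s.contDiffOn, ?_, ?_, ?_, hcore,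
    ?_, ?_⟩
  · -- closed
    intro q hq
    have hGd : DifferentiableAt ℝ G q := (hGs.contDiffAt (hopen.mem_nhds hq)).differentiableAt h1
    simp only [hG']
    rw [extDeriv_fun_add hGd (hdω₁s.differentiable h1 q), hGcl q hq,
      extDeriv_extDeriv_apply hω₁s.contDiffAt hmin, add_zero]
  · -- periodic
    intro q
    simp only [hG']
    rw [hdω₁per, hGper]
  · -- `G' = G` outside the gluing shell
    intro q hq
    simp only [hG']
    rw [hout q hq, add_zero]
  · -- POSITIVITY near the axis
    intro q hd0 hdr₁
    set d : ℝ := ‖q - hondaAxisPoint (q 0)‖ with hd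
    have hdr₂ : d ≤ r₂ := hdr₁.trans hr₁₂.le
    have hq₂ : q ∈ hondaTube r₂ := hmem₂ q (lt_of_le_of_lt hdr₁ hr₁₂)
    set t : ℝ := ρ q with ht
    have htI : t ∈ Icc (0 : ℝ) 1 := hρI q
    set x : Fin 3 → ℝ := normalPart q with hx
    set A : Matrix (Fin 3) (Fin 3) ℝ := (1 - t) • M (q 0) + t • Matrix.diagonal ![(1 : ℝ), 1, -2]
      with hA
    set α : (EuclideanSpace ℝ (Fin 4)) [⋀^Fin 2]→L[ℝ] ℝ := betaForm (A *ᵥ x) with hα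
    set R : (EuclideanSpace ℝ (Fin 4)) [⋀^Fin 2]→L[ℝ] ℝ := G q - betaForm (M (q 0) *ᵥ x) with hR
    set E : (EuclideanSpace ℝ (Fin 4)) [⋀^Fin 2]→L[ℝ] ℝ :=
      ContinuousAlternatingMap.alternatizeUncurryFin ((fderiv ℝ ρ q).smulRight (η q)) with hE
    set β : (EuclideanSpace ℝ (Fin 4)) [⋀^Fin 2]→L[ℝ] ℝ := (1 - t) • R + E with hβ
    -- the splitting `G' q = α + β`
    have hsplit : G' q = α + β := by
      have hGq : G q = betaForm (M (q 0) *ᵥ x) + R := by rw [hR]; abel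
      have hΘ : hondaFormCLM q = betaForm (Matrix.diagonal ![(1 : ℝ), 1, -2] *ᵥ x) :=
        hondaFormCLM_eq_betaForm q
      have hdω : extDeriv ω₁ q = t • (hondaFormCLM q - G q) + E := by rw [hformula q hq₂]
      have e1 : G' q = G q + (t • (hondaFormCLM q - G q) + E) := by simp only [hG', hdω]
      rw [e1, hβ, hα, hA, ← betaForm_interpolation, hΘ, hGq]
      module
    -- the main term
    have hpf : m * d ^ 2 ≤ pfaffian α := by
      rw [hα, pfaffian_betaForm, hd, ← sum_sq_normalPart]
      exact hmb (q 0) t htI x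
    have hαn : ‖α‖ ≤ CΩ * d := by
      have h := norm_betaForm_interpolation_le (hB (q 0)) htI q
      rw [hCΩ, hBβ]; exact h
    -- the error term
    have hRn : ‖R‖ ≤ C₂ * d ^ 2 := hrem q hdr₂
    have hEn : ‖E‖ ≤ 4 * η₀ * C * d := by
      have h1 := norm_wedgeTerm_le (fderiv ℝ ρ q) (η q)
      have h2 := hηb q hdr₂
      have h3 := hρd q
      have hρn := norm_nonneg (fderiv ℝ ρ q)
      calc ‖E‖ ≤ 2 * ‖fderiv ℝ ρ q‖ * ‖η q‖ := h1
        _ ≤ 2 * ‖fderiv ℝ ρ q‖ * (C * d ^ 2) := mul_le_mul_of_nonneg_left h2 (by positivity)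
        _ = 2 * C * d * (d * ‖fderiv ℝ ρ q‖) := by ring
        _ ≤ 2 * C * d * (2 * η₀) := mul_le_mul_of_nonneg_left h3 (by positivity)
        _ = 4 * η₀ * C * d := by ring
    have hβn : ‖β‖ ≤ δ * d := by
      have h1 : ‖(1 - t) • R‖ ≤ C₂ * d ^ 2 := by
        rw [norm_smul, Real.norm_eq_abs, abs_of_nonneg (by linarith [htI.2])]
        calc (1 - t) * ‖R‖ ≤ 1 * ‖R‖ := mul_le_mul_of_nonneg_right (by linarith [htI.1]) (norm_nonneg _)
          _ ≤ C₂ * d ^ 2 := by rw [one_mul]; exact hRn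
      have h2 : C₂ * d ^ 2 ≤ δ / 2 * d := by
        have : C₂ * d ≤ δ / 2 := (mul_le_mul_of_nonneg_left hdr₁ hC₂0).trans hr₁δ
        nlinarith
      have h3 : 4 * η₀ * C * d ≤ δ / 2 * d := mul_le_mul_of_nonneg_right hη₀δ hd0.le
      calc ‖β‖ ≤ ‖(1 - t) • R‖ + ‖E‖ := norm_add_le _ _
        _ ≤ δ / 2 * d + δ / 2 * d := add_le_add (h1.trans h2) (hEn.trans h3)
        _ = δ * d := by ring
    -- conclusion
    have h := pfaffian_add_ge_of_le hpf hαn hβn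
    rw [hsplit]
    have hkey : m * d ^ 2 - 6 * (CΩ * d) * (δ * d) - 3 * (δ * d) ^ 2 =
        d ^ 2 * (m - (6 * CΩ * δ + 3 * δ ^ 2)) := by ring
    rw [hkey] at h
    have hpos' : 0 < d ^ 2 * (m - (6 * CΩ * δ + 3 * δ ^ 2)) := by
      have : 0 < m - (6 * CΩ * δ + 3 * δ ^ 2) := by linarith
      positivity
    linarith
  · -- on the axis
    intro θ
    have h := hcore (hondaAxisPoint θ) (by
      rw [hondaAxisPoint_apply_zero, sub_self, norm_zero]; exact hr₀0)
    rw [h, hondaFormCLM_hondaAxisPoint]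

end Literature.Geometry.Symplectic

end
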